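import Literature.NumberTheory.Automorphic.IdeleUnitBoxSplitting
import Literature.NumberTheory.Automorphic.TateLocalFactorsProofs
import HarnessLib

/-!
# Compatibility of the splitting constants of `ν|_{B(Sᶜ)}` along `S ⊆ S'`
# (Tate (1967), §4.3: `d×a = ∏_v d×a_v` on the `S`-ideles, with `vol(𝒪_vˣ)` at the added places)

Topic `NumberTheory/Automorphic`; namespace `Literature.NumberTheory.Automorphic`. Theorems only (no
definition, no named fact, no instance). `IdeleUnitBoxSplitting` shows that for a left-invariant measure
`ν` on `𝕀_K` finite on compacts and Haar measures `μ_∞` on `K_∞ˣ`, `μ_v` on `K_vˣ`, the image of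
`ν|_{B(Sᶜ)}` under the coordinates `Θ_S(a) = (a_∞, (a_v)_{v ∈ S})` is `c_S • (μ_∞ ⊗ ⊗_{v ∈ S} μ_v)` for some
constant `c_S` (`exists_map_restrict_ideleUnitBox_compl_eq_smul`). When an idelic integral is computed over
the increasing boxes `B(Sᶜ) ⊆ B(S'ᶜ)` (`S ⊆ S'`), the constants must be compared:

* `valued_eq_one_iff_valuation_eq_one`, `isCompact_units_valued_eq_one`, `isOpen_units_valued_eq_one`,
  `measure_units_valued_eq_one_ne_zero`, `measure_units_valued_eq_one_ne_top` — the local unit group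
  `𝒪_vˣ = {y ∈ K_vˣ | |y|_v = 1}` is compact open, so of positive finite Haar measure;
* `ideleUnitBox_compl_inter_preimage_prod_pi_eq` — for every `S`, the part of the box `B(Sᶜ)` where
  `a_∞ ∈ A` and `a_v ∈ 𝒪_vˣ` for `v ∈ S` is the `S`-INDEPENDENT set `{a | a_∞ ∈ A, |a_w|_w = 1 ∀ w}`;
* `measure_archBox_eq_of_map_restrict_eq_smul` — hence `ν{a | a_∞ ∈ A, |a_w|_w = 1 ∀ w} = c_S · μ_∞(A) · ∏_{v ∈ S} μ_v(𝒪_vˣ)`;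
* `splittingConst_eq_mul_prod_of_subset` (**main**) — for `S ⊆ S'`,

    `c_S = c_{S'} · ∏_{v ∈ S' ∖ S} μ_v(𝒪_vˣ)`

  (evaluate both identities on such a set with `0 < μ_∞(A) < ∞` and cancel): the Haar measure of the
  `S'`-ideles restricted to the `S`-ideles acquires the factor `∏_{v ∈ S' ∖ S} vol(𝒪_vˣ)` (Tate (1967), §4.3,
  "we choose `d×a_v` with `∫_{𝒪_vˣ} d×a_v = 1` for almost all `v`" — here no normalisation is imposed and the
  volumes are carried along).

## References

* J. Tate, *Fourier analysis in number fields and Hecke's zeta-functions*, in Cassels–Fröhlich (1967),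
  Ch. XV §4.3 [CasselsFrohlichANT1967].
-/

noncomputable section

open MeasureTheory Measure NumberField NumberField.mixedEmbedding IsDedekindDomain Set Filter Topology ValuativeRel
open Literature.NumberTheory.GaloisRepresentations (ideleGroup unitIdeles localUnits)
open scoped ENNReal NNReal Pointwise Classical

namespace Literature.NumberTheory.Automorphic

variable {K : Type} [Field K] [NumberField K]

/-! ### 1. The local unit group has positive finite Haar measure -/

section UnitSphere

variable (v : HeightOneSpectrum (𝓞 K))

/-- Mathlib's two valuations of `K_v` agree on "`= 1`" (they are equivalent: the valuative relation of
`K_v` is defined from `Valued.v`). [folklore] -/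
theorem valued_eq_one_iff_valuation_eq_one (x : v.adicCompletion K) :
    Valued.v x = 1 ↔ valuation (v.adicCompletion K) x = 1 :=
  ((ValuativeRel.isEquiv (valuation (v.adicCompletion K))
    (Valued.v : Valuation (v.adicCompletion K) _)).eq_one_iff_eq_one).symm

/-- The two descriptions of `𝒪_vˣ ⊆ K_vˣ`. [folklore] -/
theorem setOf_units_valued_eq_one_eq :
    {y : (v.adicCompletion K)ˣ | Valued.v (y : v.adicCompletion K) = 1} =
      {y : (v.adicCompletion K)ˣ | valuation (v.adicCompletion K) (y : v.adicCompletion K) = 1} :=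
  Set.ext fun y => valued_eq_one_iff_valuation_eq_one v (y : v.adicCompletion K)

/-- `𝒪_vˣ` is compact in `K_vˣ`. [folklore] -/
theorem isCompact_units_valued_eq_one :
    IsCompact {y : (v.adicCompletion K)ˣ | Valued.v (y : v.adicCompletion K) = 1} := by
  rw [setOf_units_valued_eq_one_eq]
  exact isCompact_units_valuation_eq_one

/-- `𝒪_vˣ` is open in `K_vˣ`. [folklore] -/
theorem isOpen_units_valued_eq_one :
    IsOpen {y : (v.adicCompletion K)ˣ | Valued.v (y : v.adicCompletion K) = 1} := by
  rw [setOf_units_valued_eq_one_eq]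
  exact isOpen_units_valuation_eq_one

variable [MeasurableSpace ((v.adicCompletion K)ˣ)] [BorelSpace ((v.adicCompletion K)ˣ)]

/-- `𝒪_vˣ` is measurable. [folklore] -/
theorem measurableSet_units_valued_eq_one :
    MeasurableSet {y : (v.adicCompletion K)ˣ | Valued.v (y : v.adicCompletion K) = 1} :=
  (isOpen_units_valued_eq_one v).measurableSet

omit [BorelSpace ((v.adicCompletion K)ˣ)] in
/-- A Haar measure gives `𝒪_vˣ` positive mass (it is open and contains `1`). [folklore] -/
theorem measure_units_valued_eq_one_ne_zero (μ : Measure (v.adicCompletion K)ˣ) [μ.IsOpenPosMeasure] :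
    μ {y : (v.adicCompletion K)ˣ | Valued.v (y : v.adicCompletion K) = 1} ≠ 0 :=
  ((isOpen_units_valued_eq_one v).measure_pos μ ⟨1, by
    change Valued.v (((1 : (v.adicCompletion K)ˣ) : v.adicCompletion K)) = 1
    rw [Units.val_one, map_one]⟩).ne'

omit [BorelSpace ((v.adicCompletion K)ˣ)] in
/-- A Haar measure gives `𝒪_vˣ` finite mass (it is compact). [folklore] -/
theorem measure_units_valued_eq_one_ne_top (μ : Measure (v.adicCompletion K)ˣ) [IsFiniteMeasureOnCompacts μ] :
    μ {y : (v.adicCompletion K)ˣ | Valued.v (y : v.adicCompletion K) = 1} ≠ ∞ :=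
  (isCompact_units_valued_eq_one v).measure_lt_top.ne

end UnitSphere

/-! ### 2. Evaluating the splitting identity on archimedean boxes -/

section Constants

variable [MeasurableSpace (ideleGroup K)] [BorelSpace (ideleGroup K)]
  [MeasurableSpace ((mixedSpace K)ˣ)] [BorelSpace ((mixedSpace K)ˣ)]
  [∀ v : HeightOneSpectrum (𝓞 K), MeasurableSpace ((v.adicCompletion K)ˣ)]
  [∀ v : HeightOneSpectrum (𝓞 K), BorelSpace ((v.adicCompletion K)ˣ)]

omit [MeasurableSpace (ideleGroup K)] [BorelSpace (ideleGroup K)] [MeasurableSpace ((mixedSpace K)ˣ)]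
  [BorelSpace ((mixedSpace K)ˣ)] [∀ v : HeightOneSpectrum (𝓞 K), MeasurableSpace ((v.adicCompletion K)ˣ)]
  [∀ v : HeightOneSpectrum (𝓞 K), BorelSpace ((v.adicCompletion K)ˣ)] in
/-- **The test sets are independent of `S`.** The ideles of the box `B(Sᶜ)` whose archimedean coordinate
lies in `A` and whose `S`-coordinates are local units form the set `{a | a_∞ ∈ A, |a_w|_w = 1 ∀ w}`, whatever
`S`. [folklore] -/
theorem ideleUnitBox_compl_inter_preimage_prod_pi_eq (S : Finset (HeightOneSpectrum (𝓞 K)))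
    (A : Set (mixedSpace K)ˣ) :
    ideleUnitBox (K := K) {w | w ∉ S} ∩
        (fun a : ideleGroup K => (archUnitsOfIdele K a,
          fun v : ↥S => (GaloisRepresentations.ideleGroup.finComp v.1).toHomUnits a)) ⁻¹'
          (A ×ˢ Set.pi Set.univ fun v : ↥S =>
            {y : (v.1.adicCompletion K)ˣ | Valued.v (y : v.1.adicCompletion K) = 1}) =
      {a : ideleGroup K | archUnitsOfIdele K a ∈ A ∧
        ∀ w : HeightOneSpectrum (𝓞 K), Valued.v (((a : ideleGroup K) : AdeleRing (𝓞 K) K).2 w) = 1} := by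
  ext a
  simp only [Set.mem_inter_iff, Set.mem_preimage, Set.mem_prod, Set.mem_pi, Set.mem_univ, true_implies,
    Set.mem_setOf_eq]
  constructor
  · rintro ⟨hbox, hA, hS⟩
    refine ⟨hA, fun w => ?_⟩
    by_cases hw : w ∈ S
    · exact hS ⟨w, hw⟩
    · exact hbox w hw
  · rintro ⟨hA, hall⟩
    exact ⟨fun w _ => hall w, hA, fun v => hall v.1⟩

variable (ν : Measure (ideleGroup K))
  (μinf : Measure (mixedSpace K)ˣ) [IsHaarMeasure μinf]
  (μv : ∀ v : HeightOneSpectrum (𝓞 K), Measure (v.adicCompletion K)ˣ) [∀ v, IsHaarMeasure (μv v)]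

omit [IsHaarMeasure μinf] in
/-- **`ν{a | a_∞ ∈ A, |a_w|_w = 1 ∀ w} = c_S · μ_∞(A) · ∏_{v ∈ S} μ_v(𝒪_vˣ)`** whenever
`(Θ_S)_*(ν|_{B(Sᶜ)}) = c_S • (μ_∞ ⊗ ⊗_{v ∈ S} μ_v)` (evaluation of the splitting identity on the product set
`A × ∏_{v ∈ S} 𝒪_vˣ`). [cite: CasselsFrohlichANT1967, Ch. XV §4.3] -/
theorem measure_archBox_eq_of_map_restrict_eq_smul (S : Finset (HeightOneSpectrum (𝓞 K))) {c : ℝ≥0}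
    (hc : (ν.restrict (ideleUnitBox (K := K) {w | w ∉ S})).map
        (fun a : ideleGroup K => (archUnitsOfIdele K a,
          fun v : ↥S => (GaloisRepresentations.ideleGroup.finComp v.1).toHomUnits a)) =
      c • (μinf.prod (Measure.pi fun v : ↥S => μv v.1)))
    {A : Set (mixedSpace K)ˣ} (hA : MeasurableSet A) :
    ν {a : ideleGroup K | archUnitsOfIdele K a ∈ A ∧
        ∀ w : HeightOneSpectrum (𝓞 K), Valued.v (((a : ideleGroup K) : AdeleRing (𝓞 K) K).2 w) = 1} =
      c * μinf A * ∏ v ∈ S, μv v {y : (v.adicCompletion K)ˣ | Valued.v (y : v.adicCompletion K) = 1} := by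
  haveI : HasSummableGeomSeries (mixedSpace K) :=
    Literature.MeasureTheory.Group.hasSummableGeomSeries_of_finiteDimensional
  haveI : SecondCountableTopology (ideleGroup K) := secondCountableTopology_ideleGroup K
  haveI : SecondCountableTopology (mixedSpace K)ˣ := Literature.MeasureTheory.Group.Units.secondCountableTopology
  haveI : ∀ v : ↥S, SecondCountableTopology (v.1.adicCompletion K)ˣ := fun v =>
    secondCountableTopology_units_adicCompletion v.1
  haveI : BorelSpace ((mixedSpace K)ˣ × (∀ v : ↥S, (v.1.adicCompletion K)ˣ)) := Prod.borelSpace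
  haveI : ∀ v : ↥S, SigmaFinite (μv v.1) := fun v => inferInstance
  haveI : SigmaFinite (Measure.pi fun v : ↥S => μv v.1) := inferInstance
  have hΘm : Measurable (fun a : ideleGroup K => (archUnitsOfIdele K a,
      fun v : ↥S => (GaloisRepresentations.ideleGroup.finComp v.1).toHomUnits a)) :=
    (continuous_archUnitsOfIdele.prodMk (continuous_pi fun v => continuous_toHomUnits_finComp v.1)).measurable
  have hBm : MeasurableSet (ideleUnitBox (K := K) {w | w ∉ S}) :=
    measurableSet_ideleUnitBox_compl (fun v => GaloisRepresentations.HeckeCharacter.uniformizer K v)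
      (fun v => GaloisRepresentations.HeckeCharacter.valued_uniformizer v) S
  have hUm : ∀ v : ↥S, MeasurableSet {y : (v.1.adicCompletion K)ˣ | Valued.v (y : v.1.adicCompletion K) = 1} :=
    fun v => measurableSet_units_valued_eq_one v.1
  have hPm : MeasurableSet (A ×ˢ Set.pi Set.univ fun v : ↥S =>
      {y : (v.1.adicCompletion K)ˣ | Valued.v (y : v.1.adicCompletion K) = 1}) :=
    hA.prod (MeasurableSet.univ_pi hUm)
  have h := congrArg (fun m => m (A ×ˢ Set.pi Set.univ fun v : ↥S =>
      {y : (v.1.adicCompletion K)ˣ | Valued.v (y : v.1.adicCompletion K) = 1})) hc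
  simp only [Measure.map_apply hΘm hPm, Measure.restrict_apply' hBm, Measure.smul_apply,
    Measure.prod_prod, Measure.pi_pi] at h
  rw [Set.inter_comm, ideleUnitBox_compl_inter_preimage_prod_pi_eq S A] at h
  rw [h, ← Finset.prod_coe_sort S fun v => μv v {y : (v.adicCompletion K)ˣ | Valued.v (y : v.adicCompletion K) = 1},
    ENNReal.smul_def, smul_eq_mul, mul_assoc]

/-- **MAIN. Compatibility of the splitting constants along `S ⊆ S'`**:

  `c_S = c_{S'} · ∏_{v ∈ S' ∖ S} μ_v(𝒪_vˣ)`

whenever `(Θ_S)_*(ν|_{B(Sᶜ)}) = c_S • (μ_∞ ⊗ ⊗_{v ∈ S} μ_v)` and `(Θ_{S'})_*(ν|_{B(S'ᶜ)}) = c_{S'} • (μ_∞ ⊗ ⊗_{v ∈ S'} μ_v)`: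
both identities evaluated on `A × ∏ 𝒪_vˣ` compute the measure of the same set `{a | a_∞ ∈ A, |a_w|_w = 1 ∀ w}`,
and `0 < μ_∞(A) < ∞` for a compact neighbourhood `A` of `1`, `0 < μ_v(𝒪_vˣ) < ∞`.
[cite: CasselsFrohlichANT1967, Ch. XV §4.3] -/
theorem splittingConst_eq_mul_prod_of_subset {S S' : Finset (HeightOneSpectrum (𝓞 K))} (hSS' : S ⊆ S')
    {c c' : ℝ≥0}
    (hc : (ν.restrict (ideleUnitBox (K := K) {w | w ∉ S})).map
        (fun a : ideleGroup K => (archUnitsOfIdele K a,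
          fun v : ↥S => (GaloisRepresentations.ideleGroup.finComp v.1).toHomUnits a)) =
      c • (μinf.prod (Measure.pi fun v : ↥S => μv v.1)))
    (hc' : (ν.restrict (ideleUnitBox (K := K) {w | w ∉ S'})).map
        (fun a : ideleGroup K => (archUnitsOfIdele K a,
          fun v : ↥S' => (GaloisRepresentations.ideleGroup.finComp v.1).toHomUnits a)) =
      c' • (μinf.prod (Measure.pi fun v : ↥S' => μv v.1))) :
    (c : ℝ≥0∞) = c' * ∏ v ∈ S' \ S, μv v {y : (v.adicCompletion K)ˣ | Valued.v (y : v.adicCompletion K) = 1} := by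
  haveI : HasSummableGeomSeries (mixedSpace K) :=
    Literature.MeasureTheory.Group.hasSummableGeomSeries_of_finiteDimensional
  -- a compact neighbourhood `A` of `1` in `K_∞ˣ`: `0 < μ_∞(A) < ∞`
  obtain ⟨A, hAc, hA1⟩ := WeaklyLocallyCompactSpace.exists_compact_mem_nhds (1 : (mixedSpace K)ˣ)
  have hAm : MeasurableSet A := hAc.measurableSet
  have hA0 : μinf A ≠ 0 := (Measure.measure_pos_of_mem_nhds μinf hA1).ne'
  have hAt : μinf A ≠ ∞ := hAc.measure_lt_top.ne
  -- the unit groups: `0 < μ_v(𝒪_vˣ) < ∞`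
  set U : ∀ v : HeightOneSpectrum (𝓞 K), Set (v.adicCompletion K)ˣ := fun v =>
    {y : (v.adicCompletion K)ˣ | Valued.v (y : v.adicCompletion K) = 1} with hU
  have hU0 : ∀ v, μv v (U v) ≠ 0 := fun v => measure_units_valued_eq_one_ne_zero v (μv v)
  have hUt : ∀ v, μv v (U v) ≠ ∞ := fun v => measure_units_valued_eq_one_ne_top v (μv v)
  -- evaluate both identities
  have h1 := measure_archBox_eq_of_map_restrict_eq_smul ν μinf μv S hc hAm
  have h2 := measure_archBox_eq_of_map_restrict_eq_smul ν μinf μv S' hc' hAm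
  rw [h1, ← Finset.prod_sdiff hSS'] at h2
  -- cancel `μ_∞(A) · ∏_{v ∈ S} μ_v(𝒪_vˣ)`
  have hP0 : (∏ v ∈ S, μv v (U v)) ≠ 0 := Finset.prod_ne_zero_iff.2 fun v _ => hU0 v
  have hPt : (∏ v ∈ S, μv v (U v)) ≠ ∞ := ENNReal.prod_ne_top fun v _ => hUt v
  have h3 : (c : ℝ≥0∞) * (μinf A * ∏ v ∈ S, μv v (U v)) =
      ((c' : ℝ≥0∞) * ∏ v ∈ S' \ S, μv v (U v)) * (μinf A * ∏ v ∈ S, μv v (U v)) := by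
    calc (c : ℝ≥0∞) * (μinf A * ∏ v ∈ S, μv v (U v))
        = c * μinf A * ∏ v ∈ S, μv v (U v) := by rw [mul_assoc]
      _ = c' * μinf A * ((∏ v ∈ S' \ S, μv v (U v)) * ∏ v ∈ S, μv v (U v)) := h2
      _ = ((c' : ℝ≥0∞) * ∏ v ∈ S' \ S, μv v (U v)) * (μinf A * ∏ v ∈ S, μv v (U v)) := by ring
  exact (ENNReal.mul_left_inj (mul_ne_zero hA0 hP0) (ENNReal.mul_ne_top hAt hPt)).1 h3

/-- **The splitting of `ν|_{B(Sᶜ)}` with ONE constant for the measure identity and for product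
integrands.** For `ν` left-invariant and finite on compacts and Haar measures `μ_∞`, `μ_v` there is `c ≥ 0`
with `(Θ_S)_*(ν|_{B(Sᶜ)}) = c • (μ_∞ ⊗ ⊗_{v ∈ S} μ_v)` AND, for all integrable `g` on `K_∞ˣ` and `h_v` on `K_vˣ`
(`v ∈ S`), `a ↦ g(a_∞) ∏_{v ∈ S} h_v(a_v)` integrable on `B(Sᶜ)` with

  `∫_{B(Sᶜ)} g(a_∞) ∏_{v ∈ S} h_v(a_v) dν(a) = c · ∫ g dμ_∞ · ∏_{v ∈ S} ∫ h_v dμ_v`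

(the identities of `IdeleUnitBoxSplitting`, recorded with a shared constant so that the constant of the
integral identity is the one compared by `splittingConst_eq_mul_prod_of_subset`).
[cite: CasselsFrohlichANT1967, Ch. XV §4.3 and §4.4] -/
theorem exists_splittingConst_ideleUnitBox_compl [IsFiniteMeasureOnCompacts ν] [ν.IsMulLeftInvariant]
    (S : Finset (HeightOneSpectrum (𝓞 K))) :
    ∃ c : ℝ≥0,
      (ν.restrict (ideleUnitBox (K := K) {w | w ∉ S})).map
          (fun a : ideleGroup K => (archUnitsOfIdele K a,
            fun v : ↥S => (GaloisRepresentations.ideleGroup.finComp v.1).toHomUnits a)) =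
        c • (μinf.prod (Measure.pi fun v : ↥S => μv v.1)) ∧
      ∀ (g : (mixedSpace K)ˣ → ℂ) (h : ∀ v : ↥S, (v.1.adicCompletion K)ˣ → ℂ),
        Integrable g μinf → (∀ v, Integrable (h v) (μv v.1)) →
        IntegrableOn (fun a : ideleGroup K => g (archUnitsOfIdele K a) *
            ∏ v : ↥S, h v ((GaloisRepresentations.ideleGroup.finComp v.1).toHomUnits a))
          (ideleUnitBox (K := K) {w | w ∉ S}) ν ∧
        ∫ a in ideleUnitBox (K := K) {w | w ∉ S}, g (archUnitsOfIdele K a) *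
            ∏ v : ↥S, h v ((GaloisRepresentations.ideleGroup.finComp v.1).toHomUnits a) ∂ν =
          (c : ℂ) * (∫ x, g x ∂μinf) * ∏ v : ↥S, ∫ y, h v y ∂(μv v.1) := by
  haveI : HasSummableGeomSeries (mixedSpace K) :=
    Literature.MeasureTheory.Group.hasSummableGeomSeries_of_finiteDimensional
  haveI : SecondCountableTopology (ideleGroup K) := secondCountableTopology_ideleGroup K
  haveI : SecondCountableTopology (mixedSpace K)ˣ := Literature.MeasureTheory.Group.Units.secondCountableTopology
  haveI : ∀ v : ↥S, SecondCountableTopology (v.1.adicCompletion K)ˣ := fun v =>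
    secondCountableTopology_units_adicCompletion v.1
  haveI : BorelSpace ((mixedSpace K)ˣ × (∀ v : ↥S, (v.1.adicCompletion K)ˣ)) := Prod.borelSpace
  haveI : MeasurableMul (mixedSpace K)ˣ := ContinuousMul.measurableMul
  haveI : MeasurableMul (∀ v : ↥S, (v.1.adicCompletion K)ˣ) := ContinuousMul.measurableMul
  haveI j1 : (Measure.pi fun v : ↥S => μv v.1).IsHaarMeasure := inferInstance
  haveI j2 : SFinite (Measure.pi fun v : ↥S => μv v.1) := inferInstance
  haveI j3 : SFinite μinf := inferInstance
  haveI j4 : (μinf.prod (Measure.pi fun v : ↥S => μv v.1)).IsHaarMeasure :=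
    Measure.prod.instIsHaarMeasure μinf (Measure.pi fun v : ↥S => μv v.1)
  obtain ⟨c, hc⟩ := exists_map_restrict_ideleUnitBox_compl_eq_smul ν S (μinf.prod (Measure.pi fun v : ↥S => μv v.1))
  have hΘm : Measurable (fun a : ideleGroup K => (archUnitsOfIdele K a,
      fun v : ↥S => (GaloisRepresentations.ideleGroup.finComp v.1).toHomUnits a)) :=
    (continuous_archUnitsOfIdele.prodMk (continuous_pi fun v => continuous_toHomUnits_finComp v.1)).measurable
  refine ⟨c, hc, fun g h hg hh => ?_⟩
  -- the product integrand on `K_∞ˣ × ∏_{v ∈ S} K_vˣ`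
  have hG : AEStronglyMeasurable (fun y : ∀ v : ↥S, (v.1.adicCompletion K)ˣ => ∏ v : ↥S, h v (y v))
      (Measure.pi fun v : ↥S => μv v.1) := by
    have h' := Finset.aestronglyMeasurable_prod (Finset.univ : Finset ↥S) fun v _ =>
      (hh v).aestronglyMeasurable.comp_quasiMeasurePreserving
        (Measure.quasiMeasurePreserving_eval (fun v : ↥S => μv v.1) v)
    convert h' using 1
    funext y
    simp only [Finset.prod_apply, Function.comp_apply]
  have hGi : Integrable (fun y : ∀ v : ↥S, (v.1.adicCompletion K)ˣ => ∏ v : ↥S, h v (y v))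
      (Measure.pi fun v : ↥S => μv v.1) :=
    Integrable.fintype_prod_dep (f := h) (μ := fun v : ↥S => μv v.1) hh
  have hHi : Integrable (fun p : (mixedSpace K)ˣ × (∀ v : ↥S, (v.1.adicCompletion K)ˣ) =>
      g p.1 * ∏ v : ↥S, h v (p.2 v)) (μinf.prod (Measure.pi fun v : ↥S => μv v.1)) :=
    hg.mul_prod hGi
  -- transfer along `Θ_S`
  have hint : Integrable (fun p : (mixedSpace K)ˣ × (∀ v : ↥S, (v.1.adicCompletion K)ˣ) =>
      g p.1 * ∏ v : ↥S, h v (p.2 v)) ((ν.restrict (ideleUnitBox (K := K) {w | w ∉ S})).map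
      (fun a : ideleGroup K => (archUnitsOfIdele K a,
        fun v : ↥S => (GaloisRepresentations.ideleGroup.finComp v.1).toHomUnits a))) := by
    rw [hc]
    exact hHi.smul_measure ENNReal.coe_ne_top
  refine ⟨(integrable_map_measure hint.aestronglyMeasurable hΘm.aemeasurable).1 hint, ?_⟩
  rw [← integral_map hΘm.aemeasurable hint.aestronglyMeasurable, hc, integral_smul_nnreal_measure,
    integral_prod_mul (μ := μinf) (ν := Measure.pi fun v : ↥S => μv v.1) g (fun y => ∏ v : ↥S, h v (y v)),
    integral_fintype_prod_eq_prod (𝕜 := ℂ) h, NNReal.smul_def, Complex.real_smul, mul_assoc]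

end Constants

end Literature.NumberTheory.Automorphic
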